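import Summits.ABC.IUTFork.Joshi.TestATS4LowerBoundGenuineTame
import Summits.ABC.IUTFork.Cor312RegimeVerbatimPrVolExactRatBeds
import Summits.ABC.IUTFork.Cor312RegimeVerbatimPrVolExactDichotomy
import Summits.ABC.IUTFork.Cor312NotPointwiseDHVolBInputsExplicit
import HarnessLib

/-!
# R-J census, row Y-21ℓ — the LOCATED CONVERSE in kernel: at genuine tame data «OUR Statement ⟹ Joshi's first inequality» fails EXACTLY
# in the inflation window `0 < gap ≤ −|log(Θ)|(𝟙)`; over `ℚ` (window empty) the converse is DERIVED

Proof-only record file of the abc-iut cell, branch E → R-J «Joshi Y-discharge census» (D-0079; rung LADDER-ABC:A2.RESCUE.J; seat abc-iut-E-t59,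
gen 8; sequel of this seat's p452838 `TestATS4LowerBoundGenuine` / p453603 `…Tame` and of abc-iut-E-cx-2's rider kernel p458583 `…Vacuity`).
**No side is taken** on [IUTchIII] Cor. 3.12 / [IUTchIV] Thm 1.10, on [J-III] Cor 9.11.1.1 / [J-IV] Thm 6.10.1 (unrefereed arXiv preprints) or on
any author; typed ≠ proved ≠ endorsed; instantiated ≠ endorsed; no definition, no `Prop` fact; every printed relation stays a hypothesis BY NAME.

The census word of record for Y-21ℓ (E-plan 16:46:45Z, E-cx-2 riders R1/R2) reads «J ⟹ Statement DERIVED; antecedent KERNEL-FALSE at ℚ-beds of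
positive depth; CONVERSE LOCATED (inflation)». THIS FILE puts the located converse in kernel, two-sidedly, at abc-iut-c312-7's genuine
print-normalised setting `settingPrVolSharp X … tq t …` with EXPONENT-SHAPED pilot ideles (Θ-exponents `m_{Θ,p}(j) ∈ ℕ`, `q`-exponents
`m_q(p) ∈ ℕ`, constant over the places above each prime `p` of a finite set `U` of ODD primes UNRAMIFIED in `F` containing the primes under `S`;
abc-iut-w4-d107's convention, parts 8/12/22–24), for EVERY adelic Θ-values-locus datum `A` on `s = U` reading the genuine `q`-volumes (hq) and
hull volumes (hV). With `gap := (Σ_{p∈U} Σ_j m_{Θ,p}(j)·log p)/ℓ⋆ − Σ_{p∈U} m_q(p)·log p` and `−|log(Θ)|(𝟙) ≥ 0` the Θ-volume of the TRIVIAL ideles: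
* §1 `qLocal_…_eq_of_exponent` / `logvol_thetaHull_…_eq_of_exponent` — the two sides of the dictionary in numbers (`−m_q(p)·log p` at every
  label; `−m_{Θ,p}(j)·log p`, abc-iut-c312-5's EXACT hull value); **`cor91111_iff_gap_nonpos`** — E-cx-2's R1 as an IFF: `A.Cor91111 ↔ gap ≤ 0`
  (w4-d107 part 8's «Qside ≤ Θside», symbol for symbol); **`statement_iff_gap_le_trivial`** — `Statement ↔ ↑gap ≤ −|log(Θ)|(𝟙)` (part 12);
  **`statement_and_not_cor91111_iff_window`** — `Statement ∧ ¬A.Cor91111 ↔ 0 < gap ∧ ↑gap ≤ −|log(Θ)|(𝟙)`: the converse FAILS EXACTLY in the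
  half-open inflation window; `cor91111_iff_statement_of_trivial_eq_zero` — where `−|log(Θ)|(𝟙) = 0` the converse HOLDS; `exists_adelicLocusDatum_reading`
  — (hq) ∧ (hV) are INHABITED at every positive `q`-depth (non-vacuity of the binders).
* §2 **`cor91111_iff_statement_rat`** — over `ℚ` (part 22: `−|log(Θ)|(𝟙) = 0`) `A.Cor91111 ↔ Statement` at EVERY ℚ-bed: the converse is DERIVED
  there (both sides false at positive realising depth — part 24 / p458583 — and true at Θ-heavy data).
Over every `F ≠ ℚ` the window has POSITIVE length (part 23 `negLogTheta_settingPrVolSharp_trivial_pos_of_one_lt_finrank`); that it is HIT by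
genuine data with free `q`-depth (Dirichlet on `log p₁/log p₂`), with a concrete pilot datum over `ℚ(ζ₄)`, is the sequel `…GenuineConverseWitness`.
HONEST SCOPE: (Ind2) as typed at the real setting (`Real.ismDH`), sharp (Ind3) reading, trivial archimedean container, FREE ideles (for `P_q`-REALISING
`q`-ideles the window question is «`ℓ⋆·−|log(Θ)|(𝟙) ≥` the `q`-granularity `log p`», undecided in the tree without a quantitative hull-gain bound — stated,
not claimed); CENSUS WORD (Y-21ℓ, proposed): «J ⟹ Statement DERIVED; converse ⟺ `gap ∉ (0, −|log(Θ)|(𝟙)]` — DERIVED over ℚ, COUNTERMODEL with free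
q-depth over every F ≠ ℚ (sequel); vs S: S-BYPASSED (p447958)». [claim: Joshi2024ATS3, status: disputed] [claim: Joshi2024ATS4, status: disputed]
[claim: Mochizuki2012, status: disputed] for the items cited BY NAME; [cite: DupuyHilado2025, §3.3–§3.4, §3.6, §3.9, §4.7, §4.9] (carriers). Standard axioms.
-/

noncomputable section

open Set Function NumberField IsDedekindDomain Finset
open scoped Pointwise

namespace Summit.ABC.IUTFork.Joshi

open Thm311 Thm311.Real Cor312 Cor312.Setting Cor312Vol Literature.IUT.LogThetaLattice Literature.IUT.LogVolume
  Literature.IUT.HodgeTheaters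

namespace TestATS4LowerBound

/-! ## 0. Arithmetic helpers -/

section Helpers

/-- A sum over (the subtype of) a finite set that is the injective image of a finite index set is the sum over the indices. [folklore] -/
theorem sum_coe_eq_sum_of_iff {V β : Type} [AddCommMonoid β] {ι : Type} (emb : ι → V) (hemb : Function.Injective emb)
    (s : Finset V) (U : Finset ι) (hs : ∀ w, w ∈ s ↔ ∃ pp ∈ U, w = emb pp) (g : V → β) :
    ∑ w : s, g w = ∑ pp ∈ U, g (emb pp) := by
  classical
  have hsU : s = U.map ⟨emb, hemb⟩ := by
    ext w
    rw [hs w, Finset.mem_map]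
    constructor
    · rintro ⟨pp, hpp, rfl⟩; exact ⟨pp, hpp, rfl⟩
    · rintro ⟨pp, hpp, rfl⟩; exact ⟨pp, hpp, rfl⟩
  rw [Finset.sum_coe_sort s g, hsU, Finset.sum_map]
  rfl

end Helpers

/-! ## 1. Genuine tame data with exponent-shaped ideles: the dictionary's two sides in numbers -/

section Genuine

variable {F : Type} [Field F] [NumberField F] (X : PilotData F) {logv : PadicLogs F} (hlog : LogvAnalytic logv)
  (M : Type) [Field M] [NumberField M]
  (archPk : ∀ (j : (thetaIndex X).Label) (vQ : (thetaIndex X).VQ), Set ((logShellsDH X logv).Packet j vQ))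
  (archSub : ∀ (j : (thetaIndex X).Label) (v : (thetaIndex X).V),
    Set ((logShellsDH X logv).Packet j ((thetaIndex X).over v)))
  (Ψ : ℤ → ∀ v : (thetaIndex X).V, v ∈ (thetaIndex X).Vbad → Set ((logShellsDH X logv).StarPacket v))
  (act : ℤ → ∀ v : (thetaIndex X).V, v ∈ (thetaIndex X).Vbad →
    (logShellsDH X logv).StarPacket v → Module.End ℚ ((logShellsDH X logv).StarPacket v))
  (Mmod : ℤ → ∀ j : (thetaIndex X).LabelStar, Set ((logShellsDH X logv).GlobalPacket j.1))
  (region : ℤ → ∀ j : (thetaIndex X).LabelStar, FinDivisor M → ∀ vQ : (thetaIndex X).VQ,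
    Set ((logShellsDH X logv).Packet j.1 vQ))
  (n : ℤ) {HT : Type} {LogLink : HT → HT → Type} {IsFull : ∀ {s t : HT}, LogLink s t → Prop}
  (lat : LGPGaussianLogThetaLattice LogLink IsFull)
  {Frd : Type} {IsoF : Frd → Frd → Type} {Ob : Frd → Type} {realify : Frd → Frd} {Strip : Type}
  {IsoS : Strip → Strip → Type} {Mv : ∀ v : (thetaIndex X).V, v ∈ (thetaIndex X).Vbad → Type}
  [∀ v h, Monoid (Mv v h)]
  (sig : GlobalLGPFrobenioidSignature (thetaIndex X).lstar (thetaIndex X).V (· ∈ (thetaIndex X).Vbad)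
    Frd IsoF Ob realify Strip IsoS Mv)
  (split : SplittingMonoids Mv) {ObΔ : Type} {N : ∀ v : (thetaIndex X).V, v ∈ (thetaIndex X).Vbad → Type}
  [∀ v h, Monoid (N v h)] (qData : QPilotData ObΔ N)
  (t : ∀ (pp : Nat.Primes) (_ : Fin X.lstar) (x : (thetaIndex X).Fibre (.inr pp)),
    haveI : Fact (pp : ℕ).Prime := ⟨pp.2⟩; kOf X pp.1 x)
  (tq : ∀ (pp : Nat.Primes) (x : (thetaIndex X).Fibre (.inr pp)), haveI : Fact (pp : ℕ).Prime := ⟨pp.2⟩; kOf X pp.1 x)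
  (ht0 : ∀ pp i x, t pp i x ≠ 0)
  (ht1 : ∀ (pp : Nat.Primes) (i : Fin X.lstar) (x : (thetaIndex X).Fibre (.inr pp)),
    haveI : Fact (pp : ℕ).Prime := ⟨pp.2⟩; placeOf X pp.1 x ∉ X.S → ‖t pp i x‖ = 1)
  (htq0 : ∀ pp x, tq pp x ≠ 0)
  (htq1 : ∀ (pp : Nat.Primes) (x : (thetaIndex X).Fibre (.inr pp)),
    haveI : Fact (pp : ℕ).Prime := ⟨pp.2⟩; placeOf X pp.1 x ∉ X.S → ‖tq pp x‖ = 1)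
  (U : Finset Nat.Primes)
  (hU : ∀ (pp : Nat.Primes) (x : (thetaIndex X).Fibre (.inr pp)),
    haveI : Fact (pp : ℕ).Prime := ⟨pp.2⟩; placeOf X pp.1 x ∈ X.S → pp ∈ U)
  (hU2 : ∀ pp ∈ U, 2 < (pp : ℕ)) (hUd : ∀ pp ∈ U, ¬ ((pp : ℕ) : ℤ) ∣ NumberField.discr F)
  (mΘ : Nat.Primes → Fin (thetaIndex X).lstar → ℕ) (mq : Nat.Primes → ℕ)
  (hm : ∀ (pp : Nat.Primes), pp ∈ U → ∀ (i : Fin (thetaIndex X).lstar) (x : (thetaIndex X).Fibre (.inr pp)),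
    haveI : Fact (pp : ℕ).Prime := ⟨pp.2⟩; ‖t pp i x‖ = ‖((pp : ℕ) : ℚ_[pp]) ^ ((mΘ pp i : ℕ) : ℤ)‖)
  (hmq : ∀ (pp : Nat.Primes), pp ∈ U → ∀ (x : (thetaIndex X).Fibre (.inr pp)),
    haveI : Fact (pp : ℕ).Prime := ⟨pp.2⟩; ‖tq pp x‖ = ‖((pp : ℕ) : ℚ_[pp]) ^ ((mq pp : ℕ) : ℤ)‖)

include htq0 hmq in
/-- **The `q`-side of the dictionary in numbers**: with `q`-exponent `m_q(p)` (constant over the places above `p ∈ U`), the local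
`q`-log-volume of the genuine setting at `(j, p)` is `−m_q(p)·log p` at EVERY label (abc-iut-c312-7 `logvol_qRegion_Pr_inr`; the packet
weights sum to `1`). [cite: DupuyHilado2025, §3.6, §3.9, Thm. 3.10.1] -/
theorem qLocal_settingPrVolSharp_eq_of_exponent (i : Fin (thetaIndex X).lstar) (pp : Nat.Primes) (hpp : pp ∈ U) :
    (settingPrVolSharp X hlog M archPk archSub Ψ act Mmod region n lat sig split qData tq t htq0 htq1).qLocal
        (Setting.labelSucc i) (.inr pp) = -(mq pp : ℝ) * Real.log (pp : ℕ) := by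
  haveI : Fact (pp : ℕ).Prime := ⟨pp.2⟩
  have hloc : (settingPrVolSharp X hlog M archPk archSub Ψ act Mmod region n lat sig split qData tq t htq0 htq1).qLocal
      (Setting.labelSucc i) (.inr pp) =
        ∑ e : (presAtPr X hlog pp).toLocalPieces.E (Setting.labelSucc i),
          weightPr X pp.1 (Setting.labelSucc i) e * Real.log ‖tq pp (e (Fin.last _))‖ :=
    logvol_qRegion_Pr_inr X hlog M archPk archSub Ψ act Mmod region n tq htq0 (Setting.labelSucc i) pp
  rw [hloc]
  have hnorm : ∀ x : (thetaIndex X).Fibre (.inr pp), Real.log ‖tq pp x‖ = -(mq pp : ℝ) * Real.log (pp : ℕ) := fun x => by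
    rw [hmq pp hpp x, zpow_natCast, norm_pow, Padic.norm_p, Real.log_pow, Real.log_inv]
    ring
  simp_rw [hnorm]
  rw [← Finset.sum_mul]
  have h1 : ∑ e : (presAtPr X hlog pp).toLocalPieces.E (Setting.labelSucc i), weightPr X pp.1 (Setting.labelSucc i) e = 1 :=
    sum_weightPr_presAt X hlog pp _
  rw [h1, one_mul]

include ht0 ht1 hU2 hUd hm in
/-- **The Θ-side of the dictionary in numbers**: at an ODD prime `p ∈ U` UNRAMIFIED in `F` with Θ-exponent `m_{Θ,p}(j)` (constant over the
places above `p`), the packet-hull log-volume of the genuine setting at `(j, p)` is EXACTLY `−m_{Θ,p}(j)·log p` (abc-iut-c312-5's exact local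
value, `thetaLocal_untopD_settingPrVolSharp_eq_of_zpow`: `min` of a constant tuple, weights summing to `1`).
[cite: DupuyHilado2025, §3.6, §3.9, §4.7] [claim: Mochizuki2012, status: disputed] (the hull reading) -/
theorem logvol_thetaHull_settingPrVolSharp_eq_of_exponent (i : Fin (thetaIndex X).lstar) (pp : Nat.Primes) (hpp : pp ∈ U) :
    ((situationPrVol X hlog M archPk archSub Ψ act Mmod region).D n).logvol (Setting.labelSucc i) (.inr pp)
        ((settingPrVolSharp X hlog M archPk archSub Ψ act Mmod region n lat sig split qData tq t htq0 htq1).thetaHull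
          (Setting.labelSucc i) (.inr pp)) = -(mΘ pp i : ℝ) * Real.log (pp : ℕ) := by
  haveI : Fact (pp : ℕ).Prime := ⟨pp.2⟩
  have H := bridgeHyps_settingPrVolSharp_of_ideles X hlog M archPk archSub Ψ act Mmod region n lat sig split qData t tq ht0 ht1
    htq0 htq1
  have h2 := thetaLocal_untopD_settingPrVolSharp_eq_of_zpow X hlog M archPk archSub Ψ act Mmod region n lat sig split qData t tq ht0
    htq0 htq1 i pp (hU2 pp hpp) (hUd pp hpp) (fun _ => ((mΘ pp i : ℕ) : ℤ)) (hm pp hpp i)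
  simp only [Finset.inf'_const] at h2
  rw [← Finset.sum_mul, sum_weightPr_presAt, one_mul] at h2
  have key : ((settingPrVolSharp X hlog M archPk archSub Ψ act Mmod region n lat sig split qData tq t htq0 htq1).thetaLocal
      (Setting.labelSucc i) (.inr pp)).untopD 0 = -(mΘ pp i : ℝ) * Real.log (pp : ℕ) := by
    rw [h2]; push_cast; ring
  exact (thetaLocal_untopD H i (Sum.inr pp)).symm.trans key

/-- Sums over the places of `s` (the image of `U`) are sums over `U`. [folklore] -/
theorem sum_coe_eq_sum_of_forall_eq {s : Finset (thetaIndex X).VQ} {U : Finset Nat.Primes}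
    (hs : ∀ w, w ∈ s ↔ ∃ pp ∈ U, w = Sum.inr pp) (f : s → ℝ) (φ : Nat.Primes → ℝ)
    (hf : ∀ (w : s) (pp : Nat.Primes), pp ∈ U → (w : (thetaIndex X).VQ) = Sum.inr pp → f w = φ pp) :
    ∑ w : s, f w = ∑ pp ∈ U, φ pp := by
  set G : (thetaIndex X).VQ → ℝ := fun v => match v with
    | Sum.inl _ => 0
    | Sum.inr pp => φ pp with hGdef
  have hG : ∀ w : s, f w = G (w : (thetaIndex X).VQ) := by
    intro w
    obtain ⟨pp, hpp, hw⟩ := (hs w).1 w.2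
    rw [hf w pp hpp hw, hw]
  rw [Fintype.sum_congr _ _ hG]
  exact sum_coe_eq_sum_of_iff (V := (thetaIndex X).VQ) (fun pp : Nat.Primes => (Sum.inr pp : (thetaIndex X).VQ))
    (fun _ _ h => Sum.inr_injective h) s U hs G

variable (s : Finset (thetaIndex X).VQ) (hs : ∀ w, w ∈ s ↔ ∃ pp ∈ U, w = Sum.inr pp)
  (A : ATS3.AdelicLocusDatum (thetaIndex X).lstar s)
  (hq : ∀ (i : Fin (thetaIndex X).lstar) (w : s), Real.log (A.loc w).qroot =
    (settingPrVolSharp X hlog M archPk archSub Ψ act Mmod region n lat sig split qData tq t htq0 htq1).qLocal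
      (Setting.labelSucc i) w)
  (hV : ∀ w : s, Real.log (A.loc w).hullVol =
    ∑ i : Fin (thetaIndex X).lstar, ((situationPrVol X hlog M archPk archSub Ψ act Mmod region).D n).logvol
      (Setting.labelSucc i) w
      ((settingPrVolSharp X hlog M archPk archSub Ψ act Mmod region n lat sig split qData tq t htq0 htq1).thetaHull
        (Setting.labelSucc i) w))

include ht0 ht1 hU2 hUd hm hmq hs hq hV in
/-- **E-cx-2's rider R1 as a kernel IFF — Joshi's [J-III] Cor 9.11.1.1, read through the dictionary at genuine TAME data, IS «gap ≤ 0»**: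
for exponent-shaped pilot ideles (Θ-exponents `m_{Θ,p}(j) ≥ 0`, `q`-exponents `m_q(p)`, constant over the places above each `p ∈ U`; `U` ⊇
the primes under `S`, odd, unramified in `F`) and ANY adelic Θ-values-locus datum `A` on `s = U` reading the genuine `q`-volumes (hq) and hull
volumes (hV): `A.Cor91111 ↔ (Σ_{p∈U} Σ_j m_{Θ,p}(j)·log p)/ℓ⋆ − Σ_{p∈U} m_q(p)·log p ≤ 0` — i.e. abc-iut-w4-d107 part 8's «Qside ≤ Θside».
[claim: Joshi2024ATS3, status: disputed] (Cor 9.11.1.1 as a reading predicate); [cite: DupuyHilado2025, §3.6, §3.9, §4.7] (the carriers). -/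
theorem cor91111_iff_gap_nonpos :
    A.Cor91111 ↔
      (∑ pp ∈ U, ∑ i : Fin (thetaIndex X).lstar, (mΘ pp i : ℝ) * Real.log (pp : ℕ)) / (thetaIndex X).lstar -
          ∑ pp ∈ U, (mq pp : ℝ) * Real.log (pp : ℕ) ≤ 0 := by
  have hl : (0 : ℝ) < (thetaIndex X).lstar := by exact_mod_cast lt_of_lt_of_le two_pos (thetaIndex X).two_le_lstar
  set i₀ : Fin (thetaIndex X).lstar := ⟨0, lt_of_lt_of_le two_pos (thetaIndex X).two_le_lstar⟩ with hi₀
  have hlogp : ∀ pp : Nat.Primes, 0 ≤ Real.log (pp : ℕ) := fun pp => Real.log_nonneg (by exact_mod_cast pp.2.one_lt.le)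
  have hQ : ∑ w : s, |Real.log (A.loc w).qroot| = ∑ pp ∈ U, (mq pp : ℝ) * Real.log (pp : ℕ) :=
    sum_coe_eq_sum_of_forall_eq X hs _ _ fun w pp hpp hw => by
      rw [hq i₀ w, hw, qLocal_settingPrVolSharp_eq_of_exponent X hlog M archPk archSub Ψ act Mmod region n lat sig split qData t tq
        htq0 htq1 U mq hmq i₀ pp hpp, neg_mul, abs_neg, abs_of_nonneg (mul_nonneg (Nat.cast_nonneg _) (hlogp pp))]
  have hT : ∑ w : s, |Real.log (A.loc w).hullVol| = ∑ pp ∈ U, ∑ i : Fin (thetaIndex X).lstar, (mΘ pp i : ℝ) * Real.log (pp : ℕ) :=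
    sum_coe_eq_sum_of_forall_eq X hs _ _ fun w pp hpp hw => by
      rw [hV w, hw]
      simp_rw [logvol_thetaHull_settingPrVolSharp_eq_of_exponent X hlog M archPk archSub Ψ act Mmod region n lat sig split qData t tq ht0
        ht1 htq0 htq1 U hU2 hUd mΘ hm _ pp hpp, neg_mul, Finset.sum_neg_distrib, abs_neg]
      exact abs_of_nonneg (Finset.sum_nonneg fun i _ => mul_nonneg (Nat.cast_nonneg _) (hlogp pp))
  unfold ATS3.AdelicLocusDatum.Cor91111
  rw [hQ, hT, neg_mul, neg_le_neg_iff, one_div_mul_eq_div, sub_nonpos]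

include ht0 ht1 hU hU2 hUd hm hmq in
/-- **OUR typed Cor. 3.12 Statement at the same data IS «gap ≤ −|log(Θ)|(𝟙)»** (abc-iut-w4-d107 part 12 `statement_settingPrVolSharp_iff_exact`,
with the constant exponent tuples evaluated): `Statement ↔ ↑((Σ_p Σ_j m_{Θ,p}(j)·log p)/ℓ⋆ − Σ_p m_q(p)·log p) ≤ −|log(Θ)|(𝟙)`, where `−|log(Θ)|(𝟙) ≥ 0`
is the Θ-volume of the TRIVIAL idele configuration (the hull inflation of the unit boxes OFF the tame primes: at `2` and at the primes ramified
in `F`). [claim: Mochizuki2012, status: disputed] (the Statement); [cite: DupuyHilado2025, §3.6, §3.9, §4.7, §4.9]. -/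
theorem statement_iff_gap_le_trivial :
    (settingPrVolSharp X hlog M archPk archSub Ψ act Mmod region n lat sig split qData tq t htq0 htq1).Statement ↔
      (((∑ pp ∈ U, ∑ i : Fin (thetaIndex X).lstar, (mΘ pp i : ℝ) * Real.log (pp : ℕ)) / (thetaIndex X).lstar -
            ∑ pp ∈ U, (mq pp : ℝ) * Real.log (pp : ℕ) : ℝ) : WithTop ℝ) ≤
        (settingPrVolSharp X hlog M archPk archSub Ψ act Mmod region n lat sig split qData (fun _ _ => 1) (fun _ _ _ => 1)
          (fun _ _ => one_ne_zero) (fun _ _ _ => norm_one)).negLogTheta := by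
  have hl' : 0 < (thetaIndex X).lstar := lt_of_lt_of_le two_pos (thetaIndex X).two_le_lstar
  have hl0 : ((thetaIndex X).lstar : ℝ) ≠ 0 := by exact_mod_cast hl'.ne'
  have hiff := statement_settingPrVolSharp_iff_exact X hlog M archPk archSub Ψ act Mmod region n lat sig split qData t tq ht0 ht1 htq0
    htq1 U hU hU2 hUd (fun pp i _ => ((mΘ pp i : ℕ) : ℤ)) (fun pp hpp i x => hm pp hpp i x) (fun pp _ => ((mq pp : ℕ) : ℤ))
    (fun pp hpp x => hmq pp hpp x)
  simp only [Finset.inf'_const, ← Finset.sum_mul, sum_weightPr_presAt, one_mul, Int.cast_natCast] at hiff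
  rw [hiff]
  simp only [neg_mul]
  -- both sides are the SAME real number
  have key : processionNormalized (fun _ : Fin (thetaIndex X).lstar => ∑ pp ∈ U, -(((mq pp : ℕ) : ℝ) * Real.log (pp : ℕ))) -
      processionNormalized (fun i : Fin (thetaIndex X).lstar => ∑ pp ∈ U, -(((mΘ pp i : ℕ) : ℝ) * Real.log (pp : ℕ))) =
      (∑ pp ∈ U, ∑ i : Fin (thetaIndex X).lstar, (mΘ pp i : ℝ) * Real.log (pp : ℕ)) / (thetaIndex X).lstar -
        ∑ pp ∈ U, (mq pp : ℝ) * Real.log (pp : ℕ) := by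
    rw [processionNormalized_const hl']
    unfold processionNormalized
    rw [Finset.sum_comm]
    simp only [Finset.sum_neg_distrib, neg_div]
    ring
  rw [key]

include ht0 ht1 hU hU2 hUd hm hmq hs hq hV in
/-- **THE LOCATED CONVERSE OF Y-21ℓ IN KERNEL — the exact window.** At genuine tame data with exponent-shaped ideles, for every adelic datum
`A` reading the genuine volumes on `s = U`: **`Statement ∧ ¬ A.Cor91111 ↔ 0 < gap ∧ ↑gap ≤ −|log(Θ)|(𝟙)`**, `gap := (Σ_p Σ_j m_{Θ,p}(j)·log p)/ℓ⋆ −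
Σ_p m_q(p)·log p`. So «OUR Statement ⟹ Joshi's first inequality» FAILS EXACTLY when the exponent gap lies in the half-open INFLATION WINDOW
`(0, −|log(Θ)|(𝟙)]` — empty over `ℚ` (part 22: `−|log(Θ)|(𝟙) = 0`), of positive length over every other number field (part 23). This is the
census word's «converse located (inflation)» as a biconditional; no side taken. [claim: Joshi2024ATS3, status: disputed] [claim: Mochizuki2012,
status: disputed] [cite: DupuyHilado2025, §3.6, §3.9, §4.7, §4.9] -/
theorem statement_and_not_cor91111_iff_window :
    ((settingPrVolSharp X hlog M archPk archSub Ψ act Mmod region n lat sig split qData tq t htq0 htq1).Statement ∧ ¬ A.Cor91111) ↔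
      (0 < (∑ pp ∈ U, ∑ i : Fin (thetaIndex X).lstar, (mΘ pp i : ℝ) * Real.log (pp : ℕ)) / (thetaIndex X).lstar -
            ∑ pp ∈ U, (mq pp : ℝ) * Real.log (pp : ℕ) ∧
        (((∑ pp ∈ U, ∑ i : Fin (thetaIndex X).lstar, (mΘ pp i : ℝ) * Real.log (pp : ℕ)) / (thetaIndex X).lstar -
              ∑ pp ∈ U, (mq pp : ℝ) * Real.log (pp : ℕ) : ℝ) : WithTop ℝ) ≤
          (settingPrVolSharp X hlog M archPk archSub Ψ act Mmod region n lat sig split qData (fun _ _ => 1) (fun _ _ _ => 1)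
            (fun _ _ => one_ne_zero) (fun _ _ _ => norm_one)).negLogTheta) := by
  rw [statement_iff_gap_le_trivial X hlog M archPk archSub Ψ act Mmod region n lat sig split qData t tq ht0 ht1 htq0 htq1 U hU hU2 hUd mΘ
    mq hm hmq, cor91111_iff_gap_nonpos X hlog M archPk archSub Ψ act Mmod region n lat sig split qData t tq ht0 ht1 htq0 htq1 U hU2 hUd
    mΘ mq hm hmq s hs A hq hV, not_le, and_comm]

include ht0 ht1 hU hU2 hUd hm hmq hs hq hV in
/-- **Where the trivial inflation VANISHES, the converse HOLDS: `A.Cor91111 ↔ Statement`.** If `−|log(Θ)|(𝟙) = 0` at the context — the case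
of EVERY pilot datum over `ℚ` (abc-iut-w4-d107 part 22 `negLogTheta_settingPrVolSharp_trivial_eq_zero_rat`) — then at genuine tame data with
exponent-shaped ideles Joshi's first inequality read through the dictionary and OUR typed Cor. 3.12 Statement are EQUIVALENT (both say
`gap ≤ 0`): the converse of Y-21ℓ is DERIVED at every ℚ-bed (where, by E-cx-2's R2 / p458583, both sides are FALSE at positive realising depth).
[claim: Joshi2024ATS3, status: disputed] [claim: Mochizuki2012, status: disputed] [cite: DupuyHilado2025, §3.6, §3.9, §4.7] -/
theorem cor91111_iff_statement_of_trivial_eq_zero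
    (hκ : (settingPrVolSharp X hlog M archPk archSub Ψ act Mmod region n lat sig split qData (fun _ _ => 1) (fun _ _ _ => 1)
      (fun _ _ => one_ne_zero) (fun _ _ _ => norm_one)).negLogTheta = ((0 : ℝ) : WithTop ℝ)) :
    A.Cor91111 ↔ (settingPrVolSharp X hlog M archPk archSub Ψ act Mmod region n lat sig split qData tq t htq0 htq1).Statement := by
  rw [statement_iff_gap_le_trivial X hlog M archPk archSub Ψ act Mmod region n lat sig split qData t tq ht0 ht1 htq0 htq1 U hU hU2 hUd mΘ
    mq hm hmq, cor91111_iff_gap_nonpos X hlog M archPk archSub Ψ act Mmod region n lat sig split qData t tq ht0 ht1 htq0 htq1 U hU2 hUd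
    mΘ mq hm hmq s hs A hq hV, hκ, WithTop.coe_le_coe]

include htq0 hmq hs in
/-- **NON-VACUITY of the dictionary binders (hq), (hV)**: if every `q`-exponent on `U` is `≥ 1` (positive `q`-depth, `|q_w^{1/2ℓ}| < 1`), there IS an
adelic Θ-values-locus datum on `s = U` reading the genuine volumes: `|q_w^{1/2ℓ}| := exp(−m_q(p)·log p)`, `Vol(Θ̃_w) := exp(Σ_j logvol(ⁿ˒°𝒰_{j,p}))`. [folklore] -/
theorem exists_adelicLocusDatum_reading (hmq1 : ∀ pp ∈ U, 1 ≤ mq pp) :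
    ∃ A : ATS3.AdelicLocusDatum (thetaIndex X).lstar s,
      (∀ (i : Fin (thetaIndex X).lstar) (w : s), Real.log (A.loc w).qroot =
        (settingPrVolSharp X hlog M archPk archSub Ψ act Mmod region n lat sig split qData tq t htq0 htq1).qLocal
          (Setting.labelSucc i) w) ∧
      (∀ w : s, Real.log (A.loc w).hullVol =
        ∑ i : Fin (thetaIndex X).lstar, ((situationPrVol X hlog M archPk archSub Ψ act Mmod region).D n).logvol
          (Setting.labelSucc i) w
          ((settingPrVolSharp X hlog M archPk archSub Ψ act Mmod region n lat sig split qData tq t htq0 htq1).thetaHull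
            (Setting.labelSucc i) w)) := by
  set P := settingPrVolSharp X hlog M archPk archSub Ψ act Mmod region n lat sig split qData tq t htq0 htq1 with hP
  set i₀ : Fin (thetaIndex X).lstar := ⟨0, lt_of_lt_of_le two_pos (thetaIndex X).two_le_lstar⟩ with hi₀
  have hval : ∀ (i : Fin (thetaIndex X).lstar) (w : s), ∃ pp ∈ U, (w : (thetaIndex X).VQ) = Sum.inr pp ∧
      P.qLocal (Setting.labelSucc i) w = -(mq pp : ℝ) * Real.log (pp : ℕ) := by
    intro i w
    obtain ⟨pp, hpp, hw⟩ := (hs w).1 w.2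
    refine ⟨pp, hpp, hw, ?_⟩
    rw [hw]
    exact qLocal_settingPrVolSharp_eq_of_exponent X hlog M archPk archSub Ψ act Mmod region n lat sig split qData t tq htq0 htq1 U mq hmq
      i pp hpp
  have hneg : ∀ w : s, P.qLocal (Setting.labelSucc i₀) w < 0 := by
    intro w
    obtain ⟨pp, hpp, -, hv⟩ := hval i₀ w
    rw [hv, neg_mul, neg_lt_zero]
    exact mul_pos (by exact_mod_cast hmq1 pp hpp) (Real.log_pos (by exact_mod_cast pp.2.one_lt))
  refine ⟨⟨fun w =>
    { qroot := Real.exp (P.qLocal (Setting.labelSucc i₀) w)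
      qroot_pos := Real.exp_pos _
      qroot_lt_one := Real.exp_lt_one_iff.mpr (hneg w)
      theta := fun _ => 1
      supNorm := 1
      hullVol := Real.exp (∑ i : Fin (thetaIndex X).lstar, ((situationPrVol X hlog M archPk archSub Ψ act Mmod region).D n).logvol
        (Setting.labelSucc i) w (P.thetaHull (Setting.labelSucc i) w)) }⟩, fun i w => ?_, fun w => ?_⟩
  · show Real.log (Real.exp _) = _
    rw [Real.log_exp]
    obtain ⟨pp, hpp, hw, hv⟩ := hval i₀ w
    obtain ⟨pp', hpp', hw', hv'⟩ := hval i w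
    have hpp_eq : pp = pp' := Sum.inr_injective (hw.symm.trans hw')
    subst hpp_eq
    rw [hv, hv']
  · show Real.log (Real.exp _) = _
    rw [Real.log_exp]

end Genuine

/-! ## 2. Over `ℚ` the converse is DERIVED: `A.Cor91111 ↔ Statement` at every ℚ-bed -/

section RatBeds

variable (X : PilotData ℚ) {logv : PadicLogs ℚ} (hlog : LogvAnalytic logv)
  (M : Type) [Field M] [NumberField M]
  (archPk : ∀ (j : (thetaIndex X).Label) (vQ : (thetaIndex X).VQ), Set ((logShellsDH X logv).Packet j vQ))
  (archSub : ∀ (j : (thetaIndex X).Label) (v : (thetaIndex X).V),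
    Set ((logShellsDH X logv).Packet j ((thetaIndex X).over v)))
  (Ψ : ℤ → ∀ v : (thetaIndex X).V, v ∈ (thetaIndex X).Vbad → Set ((logShellsDH X logv).StarPacket v))
  (act : ℤ → ∀ v : (thetaIndex X).V, v ∈ (thetaIndex X).Vbad →
    (logShellsDH X logv).StarPacket v → Module.End ℚ ((logShellsDH X logv).StarPacket v))
  (Mmod : ℤ → ∀ j : (thetaIndex X).LabelStar, Set ((logShellsDH X logv).GlobalPacket j.1))
  (region : ℤ → ∀ j : (thetaIndex X).LabelStar, FinDivisor M → ∀ vQ : (thetaIndex X).VQ,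
    Set ((logShellsDH X logv).Packet j.1 vQ))
  (n : ℤ) {HT : Type} {LogLink : HT → HT → Type} {IsFull : ∀ {s t : HT}, LogLink s t → Prop}
  (lat : LGPGaussianLogThetaLattice LogLink IsFull)
  {Frd : Type} {IsoF : Frd → Frd → Type} {Ob : Frd → Type} {realify : Frd → Frd} {Strip : Type}
  {IsoS : Strip → Strip → Type} {Mv : ∀ v : (thetaIndex X).V, v ∈ (thetaIndex X).Vbad → Type}
  [∀ v h, Monoid (Mv v h)]
  (sig : GlobalLGPFrobenioidSignature (thetaIndex X).lstar (thetaIndex X).V (· ∈ (thetaIndex X).Vbad)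
    Frd IsoF Ob realify Strip IsoS Mv)
  (split : SplittingMonoids Mv) {ObΔ : Type} {N : ∀ v : (thetaIndex X).V, v ∈ (thetaIndex X).Vbad → Type}
  [∀ v h, Monoid (N v h)] (qData : QPilotData ObΔ N)
  (t : ∀ (pp : Nat.Primes) (_ : Fin X.lstar) (x : (thetaIndex X).Fibre (.inr pp)),
    haveI : Fact (pp : ℕ).Prime := ⟨pp.2⟩; kOf X pp.1 x)
  (tq : ∀ (pp : Nat.Primes) (x : (thetaIndex X).Fibre (.inr pp)), haveI : Fact (pp : ℕ).Prime := ⟨pp.2⟩; kOf X pp.1 x)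
  (ht0 : ∀ pp i x, t pp i x ≠ 0)
  (ht1 : ∀ (pp : Nat.Primes) (i : Fin X.lstar) (x : (thetaIndex X).Fibre (.inr pp)),
    haveI : Fact (pp : ℕ).Prime := ⟨pp.2⟩; placeOf X pp.1 x ∉ X.S → ‖t pp i x‖ = 1)
  (htq0 : ∀ pp x, tq pp x ≠ 0)
  (htq1 : ∀ (pp : Nat.Primes) (x : (thetaIndex X).Fibre (.inr pp)),
    haveI : Fact (pp : ℕ).Prime := ⟨pp.2⟩; placeOf X pp.1 x ∉ X.S → ‖tq pp x‖ = 1)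
  (U : Finset Nat.Primes)
  (hU : ∀ (pp : Nat.Primes) (x : (thetaIndex X).Fibre (.inr pp)),
    haveI : Fact (pp : ℕ).Prime := ⟨pp.2⟩; placeOf X pp.1 x ∈ X.S → pp ∈ U)
  (hU2 : ∀ pp ∈ U, 2 < (pp : ℕ))
  (mΘ : Nat.Primes → Fin (thetaIndex X).lstar → ℕ) (mq : Nat.Primes → ℕ)
  (hm : ∀ (pp : Nat.Primes), pp ∈ U → ∀ (i : Fin (thetaIndex X).lstar) (x : (thetaIndex X).Fibre (.inr pp)),
    haveI : Fact (pp : ℕ).Prime := ⟨pp.2⟩; ‖t pp i x‖ = ‖((pp : ℕ) : ℚ_[pp]) ^ ((mΘ pp i : ℕ) : ℤ)‖)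
  (hmq : ∀ (pp : Nat.Primes), pp ∈ U → ∀ (x : (thetaIndex X).Fibre (.inr pp)),
    haveI : Fact (pp : ℕ).Prime := ⟨pp.2⟩; ‖tq pp x‖ = ‖((pp : ℕ) : ℚ_[pp]) ^ ((mq pp : ℕ) : ℤ)‖)
  (s : Finset (thetaIndex X).VQ) (hs : ∀ w, w ∈ s ↔ ∃ pp ∈ U, w = Sum.inr pp)
  (A : ATS3.AdelicLocusDatum (thetaIndex X).lstar s)
  (hq : ∀ (i : Fin (thetaIndex X).lstar) (w : s), Real.log (A.loc w).qroot =
    (settingPrVolSharp X hlog M archPk archSub Ψ act Mmod region n lat sig split qData tq t htq0 htq1).qLocal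
      (Setting.labelSucc i) w)
  (hV : ∀ w : s, Real.log (A.loc w).hullVol =
    ∑ i : Fin (thetaIndex X).lstar, ((situationPrVol X hlog M archPk archSub Ψ act Mmod region).D n).logvol
      (Setting.labelSucc i) w
      ((settingPrVolSharp X hlog M archPk archSub Ψ act Mmod region n lat sig split qData tq t htq0 htq1).thetaHull
        (Setting.labelSucc i) w))

include ht0 ht1 hU hU2 hm hmq hs hq hV in
/-- **THE CONVERSE OF Y-21ℓ IS DERIVED AT EVERY ℚ-BED.** For a pilot datum over `ℚ` (every place of `S` over a finite set `U` of ODD primes —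
unramified automatically, `disc ℚ = 1`), exponent-shaped pilot ideles and ANY adelic Θ-values-locus datum `A` on `s = U` reading the genuine
volumes: **`A.Cor91111 ↔ Statement`** — Joshi's [J-III] Cor 9.11.1.1 read through the dictionary and OUR typed [IUTchIII] Cor. 3.12 Statement
COINCIDE at the cell's ℚ-beds (abc-iut-w4-d107 part 22: `−|log(Θ)|(𝟙) = 0` over `ℚ`; both say `gap ≤ 0`; both FALSE at positive realising depth
— part 24 / E-cx-2's R2 p458583 —, both TRUE at Θ-heavy data). `ℚ` is NOT the base field of any initial Θ-datum (`√−1 ∉ ℚ`): a bed, not a model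
of print. [claim: Joshi2024ATS3, status: disputed] [claim: Mochizuki2012, status: disputed] [cite: DupuyHilado2025, §3.6, §3.9, §4.7] -/
theorem cor91111_iff_statement_rat :
    A.Cor91111 ↔ (settingPrVolSharp X hlog M archPk archSub Ψ act Mmod region n lat sig split qData tq t htq0 htq1).Statement := by
  have hUd : ∀ pp ∈ U, ¬ ((pp : ℕ) : ℤ) ∣ NumberField.discr ℚ := fun pp _ h => by
    rw [Rat.numberField_discr] at h
    have h1 := Int.eq_one_of_dvd_one (Int.natCast_nonneg _) h
    exact pp.2.one_lt.ne' (by exact_mod_cast h1)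
  exact cor91111_iff_statement_of_trivial_eq_zero X hlog M archPk archSub Ψ act Mmod region n lat sig split qData t tq ht0 ht1 htq0 htq1 U
    hU hU2 hUd mΘ mq hm hmq s hs A hq hV
    (negLogTheta_settingPrVolSharp_trivial_eq_zero_rat X hlog M archPk archSub Ψ act Mmod region n lat sig split qData)

end RatBeds

end TestATS4LowerBound

end Summit.ABC.IUTFork.Joshi

end
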